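/-
Copyright (c) 2026 the pub-hodgecm-mathlib formalisation cell (harness21).  Prover seat hodgecm-mathlib-K2E4-p07 (g4), Track B «K2-LIT» ∕ h413
(stmt-HodgeConjecture-24833, supports-only), ‹S› ROAD J ∕ R3 «RANK-ONE MASS», road (d-w) = leaf (J3d-w) (owner K2E3-p03 (g3)): the PLACE-GENERIC block model of the
COMPACT SHEET from a global non-norm `ξ₀` in ALGEBRAIC currency (dealer K2E3-plan (g2) DEAL (D36) 02:41Z «wild block-model twins»; twin of ★ R3g p856521 (this lineage,
inert) and ★ R3g-ram p856749 (K2E3-p17 (g4), tame); companion of ★ p856836 `K2E3DockBlockModelOfNotNorm` (K2E4-p18 (g4), the dock)).  2026-09-04.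
-/
import Summits.HodgeConjecture.HodgeConjecture.Theorems.K2E3CompactSheetBlockModel      -- ★ R3g p856521 (K2E4-p07 (g3)): `blocks_of_twistGram_eq_finSum`, `exists_gl_one_formCongr_eq`; brings ★ kit p856451 + the place-free local algebra
import Summits.HodgeConjecture.HodgeConjecture.Theorems.K2E3DockBlockModelOfNotNorm       -- ★ p856836 (K2E4-p18 (g4)): `exists_rescale_of_not_norm` (norm index two in algebraic currency) — ONE rescaling lemma for dock AND sheet
import HarnessLib

/-!
# ‹S› road J ∕ R3 — R3g-gen «BLOCK MODEL OF THE COMPACT SHEET FROM A GLOBAL NON-NORM» (any non-split place: inert, tame or WILD ramified): the second class `ε′` of the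
# κ-block is, through a local form congruence, a BLOCK-SCALAR point of `U(⟨1, −ξ₀⟩ ⊕ᶠ ⟨c_b⟩)(L⁺_v)` with GLOBAL blocks, `c_b ∈ {1, ξ₀}` (Rogawski 1990 §3.8 Prop. 3.8.1 (a),(d) p. 30; §8.1 p. 116)

Cell `pub/hodgecm-mathlib`, Track B «K2-LIT», crux H413 = `stmt-HodgeConjecture-24833`; ‹S› ROAD J, letter ‹J3› (v2) `sig_K2E3CompatibleMeasureEPIdentityRankOne`, residue class
(J3d-w) `U3bCentralGermsLeaves.sig_K2E3CompatibleMeasureEPIdentityRankOneDyadicRamified` (PART C :333; road (d-w), owner K2E3-p03 (g3), CENSUS-J3dw §1 row «p856749 … PORTS with the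
kit swapped for W1», §3 W1, §4), payer road R3 «RANK-ONE MASS» (owner K2E3-p15 (g3)).  THEOREMS ONLY (no definition, no instance, no notation, no `sorry`; DEFAULT heartbeats —
★ R3g-ram's 1.6 M budget line is not needed once step (4) is the named lemma); lane `--supports stmt-HodgeConjecture-24833 --as helper`; namespace `Summit.HodgeConjecture.HodgeConjecture.Cruxes.H413.K2E3CompactSheetBlockModelOfNotNorm`.

WHY THIS FILE.  ★ R3g `K2E3CompactSheetBlockModel.exists_blockModel_compactSheet` (inert: `ξ = ϖ_v` via `IsUnramifiedIn`) and ★ R3g-ram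
`K2E3CompactSheetBlockModelRamified.exists_blockModel_compactSheet_ramified` (tame ramified, `2 ∉ v`: `ξ` a global unit of non-square residue, exported with the VALUATION clause
`hξN : ∀ u, |u|_w = 1 → |σ_w(u)·u − ξ|_w = 1`) run ONE place-generic argument whose only local input is a global `ξ₀ ∈ L⁺` representing the non-trivial class of
`(L ⊗ L⁺_v)^{σ,×} ∕ {σ(z)·z}` (order two at every non-split `v`, ★ `exists_norm_mul_of_not_exists_norm`).  At a WILD place (`2 ∈ v`, `e(w|v) = 2`) the clause `hξN` is
UNSATISFIABLE (`q` even, `σ̄ = id`: every residue is a square — CENSUS-J3dw §0.2), so road (d-w) needs the sheet's block model with the non-norm input in the ALGEBRAIC currency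
`hξnn : ¬ ∃ z, IsUnit z ∧ ι(ξ₀) = (c ⊗ 1)(z)·z` — EXACTLY the binder convention `(ξ₀) (hξc) (hξ0) (hξnn)` of the dock companion ★ `K2E3DockBlockModelOfNotNorm.exists_blockModel_dock_of_not_norm`
(K2E4-p18 (g4)), so that the (J3d-w) assembler (W4) feeds ONE `ξ₀`-package (the wild kit W1, K2E5-p16 (g3)) to sheet and dock.  This file:

* §1 **`exists_blockModel_compactSheet_of_not_norm`** — binders = ★ R3g-ram's with the place hypotheses `(he) (h2)` REPLACED by the input `(ξ₀ : L) (hξc : c ξ₀ = ξ₀) (hξ0 : ξ₀ ≠ 0)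
  (hξnn)`; from the ‹J3 v2› frame (central point `ε_H = (a·1₂, u)`, dock `θ` read in `GL₃` by `y`, swap `W`, dock frame `(G₁, G₂)`, bad frame `(P′, G₁′, G₂′)` with
  `det G₁′ ∉ det G₁ · N`, second class `ε′` framed by `P′`) at ANY non-split `v` (`c • w = w`): a GLOBAL `c_b ∈ {1, ξ₀}` (non-zero, `complexConj`-fixed), a local change of basis
  `T ∈ GL₃(L ⊗ L⁺_v)` with `ᵗ(σT)·H′_v·T = (⟨1, −ξ₀⟩ ⊕ᶠ ⟨c_b⟩)_v` (scalar `1`) and the block-scalar preimage `x = φ_T⁻¹ ε′ ∈ U(⟨1,−ξ₀⟩ ⊕ᶠ ⟨c_b⟩)(L⁺_v)` (matrix `a·1₂ ⊕ᶠ u·1₁`,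
  `a − u` a unit, `φ_T x = ε′`) — the output of ★ R3g-ram minus its two `ξ`-valuation clauses (now INPUT facts the assembler already holds), byte-identical otherwise.
* SPECIALISATIONS (no restatement filed — ★ statements are not duplicated): inert `ξ₀ := ϖ_v` with `hξnn :=` ★ R3g `not_exists_uniformizer_eq_norm` (★ kit
  `exists_global_uniformizer`); tame `⟨ξ₀, hξc, hξ1, hξN, -, -, hξnn⟩ :=` ★ `K2E3CompactSheetBlockModelRamified.exists_global_unit_not_norm_localRing L v w hw he h2` (`hξ0 ⇐ hξ1`);
  WILD: `ξ₀` and `hξnn` from the wild norm kit (W1) of road (d-w) (CENSUS-J3dw §3: `[𝒪_v^× : N(𝒪_w^×)] = 2`, unit-norm conductor, global approximation).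

THE PROOF (all inputs ★; R3g-ram's body token for token but for the source of `ξ₀`).  (1) The bad block is ANISOTROPIC: `−det G₁′ ∉ N` (★ `not_exists_neg_det_badBlock_eq_norm`).
(2) `ϖ := ι(ξ₀)` is a `σ`-fixed unit which is NOT a norm (`hξnn`), so by index two `−det G₁′ = N(z)·ϖ`, i.e. `det ⟨1,−ξ₀⟩_v = −ϖ = det G₁′ · N(z⁻¹)`; Jacobowitz (★
`exists_formCongr_eq_of_det_eq_mul_norm`) gives `S₁` with `ᵗσ(S₁) G₁′ S₁ = ⟨1, −ξ₀⟩_v`.  (3) The line: `g = (G₂′)₀₀` is a `σ`-fixed unit; ★ `exists_rescale_of_not_norm` gives a unit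
`s` and `c_b ∈ {1, ξ₀}` with `σ(s)·g·s = ι(c_b)`; `S₂ := (s)`.  (4) `T := P′·(S₁ ⊕ᶠ S₂)`, `x := φ_T⁻¹ ε′`, matrix `(S₁⊕S₂)⁻¹(a·1 ⊕ᶠ u)(S₁⊕S₂) = a·1 ⊕ᶠ u`.

HONEST LABEL: HC_CM is proved only modulo the 7 printed citations (2 remaining named inputs: hLiu418 = stmt-HodgeConjecture-24832, h413 = stmt-HodgeConjecture-24833) until rung 0
closes; this file is a count-neutral helper (local algebra + local class field theory of a quadratic extension of local fields, no parity hypothesis); (J3d-w) is NOT proved here —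
its wild-only arithmetic (CENSUS-J3dw §3: W1 kit, (E-w), the Lie Gram numbers, the residual-count ratio (W3)) is elsewhere.

## References
* [Rogawski1990] J. D. Rogawski, *Automorphic Representations of Unitary Groups in Three Variables*, Ann. of Math. Stud. 123 (1990), §3.8 Prop. 3.8.1 (a),(d) p. 30; §8.1 p. 116;
  §3.5 Prop. 3.5.2 (a) p. 29.
* [Jacobowitz1962] R. Jacobowitz, *Hermitian forms over local fields*, Amer. J. Math. 84 (1962), §3 Thm. 3.1 (classification of hermitian spaces by rank and determinant class —
  every local quadratic extension, dyadic ramified included).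
* [Omeara1963] O. T. O'Meara, *Introduction to Quadratic Forms* (1963), §63B Prop. 63:13 (local norm index two).
* [Serre1979] J.-P. Serre, *Local Fields*, GTM 67 (1979), Ch. V §3 (norm groups of ramified quadratic extensions; Cor. 3 for the wild unit-norm conductor).
* [PlatonovRapinchuk1994] V. Platonov, A. Rapinchuk, *Algebraic Groups and Number Theory* (1994), §2.3, §5.1.
-/

set_option autoImplicit false
set_option linter.dupNamespace false

noncomputable section

open NumberField IsDedekindDomain Matrix
open Literature.NumberTheory.Automorphic Literature.NumberTheory.Automorphic.UnitaryGroup Literature.NumberTheory.GaloisRepresentations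
open Literature.NumberTheory.Rogawski1990 Literature.NumberTheory.Weil1982.UnitaryFinTopForm
open Summit.HodgeConjecture.HodgeConjecture.Cruxes.H413.K2E3CompactSheetBlockModelKit
open Summit.HodgeConjecture.HodgeConjecture.Cruxes.H413.K2E3CompactSheetBlockModel
open scoped MatrixGroups

namespace Summit.HodgeConjecture.HodgeConjecture.Cruxes.H413.K2E3CompactSheetBlockModelOfNotNorm

variable (L : Type) [Field L] [NumberField L] [IsCMField L] (H' : Matrix (Fin 3) (Fin 3) L)
  (hherm : (H'.map (cmConjRingHom L))ᵀ = H') (hanis : ∀ x : Fin 3 → L, Literature.AlgebraicGeometry.ShimuraVarieties.hermForm (cmConjRingHom L) H' x x = 0 → x = 0)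
  (v : HeightOneSpectrum (𝓞 ↥(maximalRealSubfield L))) (w : PlacesOver L v) (hw : IsCMField.complexConj L • w.1 = w.1)
  (ξ₀ : L) (hξc : IsCMField.complexConj L ξ₀ = ξ₀) (hξ0 : ξ₀ ≠ 0)
  (hξnn : ¬ ∃ z : LocalRing L v, IsUnit z ∧ algebraMap L (LocalRing L v) ξ₀ = conjLocal L (IsCMField.complexConj L) v z * z)


/-! ## §1 The block model of the compact sheet from a global non-norm (any non-split place) -/

include hherm hanis hw hξc hξ0 hξnn in
/-- **R3g-gen «BLOCK MODEL OF THE COMPACT SHEET FROM A GLOBAL NON-NORM» (place-generic).**  See the module docstring: from the ‹J3 v2› frame (central point, dock `θ` with its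
`GL₃`-reading `y`, swap `W`, dock frame `(G₁, G₂)`, bad frame `(P′, G₁′, G₂′)` with `det G₁′ ∉ det G₁ · N`, second class `ε′` framed by `P′`) at ANY non-split `v` (`c • w = w`) and a
GLOBAL `ξ₀ ∈ L⁺ ∖ 0` whose image in `L ⊗ L⁺_v` is NOT of the form `σ(z)·z`, `z` a unit (`hξnn`, algebraic currency): a GLOBAL `c_b ∈ {1, ξ₀}` (`c c_b = c_b`, `c_b ≠ 0`), a congruence
`T` with `ᵗ(σT) H′_v T = (!![1,0;0,−ξ₀] ⊕ᶠ !![c_b])_v` (scalar `1`), and the block-scalar preimage `x = φ_T⁻¹ ε′` (matrix `a·1₂ ⊕ᶠ u·1₁`, `a − u` a unit, `φ_T x = ε′`).  Output =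
★ R3g-ram `exists_blockModel_compactSheet_ramified`'s minus the two `ξ`-valuation clauses; binder convention `(ξ₀) (hξc) (hξ0) (hξnn)` = ★ `exists_blockModel_dock_of_not_norm`'s.
Specialisations: inert `ξ₀ := ϖ_v` (★ kit `exists_global_uniformizer` + ★ R3g `not_exists_uniformizer_eq_norm`), tame `ξ₀ :=` ★ `exists_global_unit_not_norm_localRing`, WILD
`ξ₀` from the wild norm kit (W1) of road (d-w). [cite: Rogawski1990, §3.8 Prop. 3.8.1 (a),(d) p. 30; §8.1 p. 116; §3.5 Prop. 3.5.2 (a) p. 29] [cite: Jacobowitz1962, §3 Thm. 3.1]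
[cite: Omeara1963, §63B Prop. 63:13] -/
theorem exists_blockModel_compactSheet_of_not_norm
    (εH : ((cmDatum L 2 (Matrix.of fun i j : Fin 2 => if i.val + j.val + 1 = 2 then (1 : L) else 0)).Local v ×
      (cmDatum L 1 (Matrix.of fun i j : Fin 1 => if i.val + j.val + 1 = 1 then (1 : L) else 0)).Local v)) (a : LocalRing L v)
    (hu : (εH.2.val.val : Matrix (Fin 1) (Fin 1) (LocalRing L v)) 0 0 ≠ a)
    {ε : (cmDatum L 3 H').Local v} {y : GL (Fin 3) (LocalRing L v)}
    (θ : ((cmDatum L 2 (Matrix.of fun i j : Fin 2 => if i.val + j.val + 1 = 2 then (1 : L) else 0)).Local v ×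
      (cmDatum L 1 (Matrix.of fun i j : Fin 1 => if i.val + j.val + 1 = 1 then (1 : L) else 0)).Local v) ≃ₜ* ↥(Subgroup.centralizer ({ε} : Set ((cmDatum L 3 H').Local v))))
    (hθ : ∀ z : ((cmDatum L 2 (Matrix.of fun i j : Fin 2 => if i.val + j.val + 1 = 2 then (1 : L) else 0)).Local v ×
      (cmDatum L 1 (Matrix.of fun i j : Fin 1 => if i.val + j.val + 1 = 1 then (1 : L) else 0)).Local v),
      (((θ z).1).val : GL (Fin 3) (LocalRing L v)) = y * ((endoEmbLocal L v z).val : GL (Fin 3) (LocalRing L v)) * y⁻¹)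
    {W : GL (Fin 3) (LocalRing L v)} (hW : W.val = !![(1 : LocalRing L v), 0, 0; 0, 0, 1; 0, 1, 0])
    {G₁ G₁' : Matrix (Fin 2) (Fin 2) (LocalRing L v)} {G₂ G₂' : Matrix (Fin 1) (Fin 1) (LocalRing L v)} (P' : GL (Fin (2 + 1)) (LocalRing L v))
    (hPW : twistGram (conjLocal L (IsCMField.complexConj L) v) ((adelicForm L 3 H').map (adeleToLocal L v)) (y * W).val = finSum 2 1 G₁ G₂)
    (hP' : twistGram (conjLocal L (IsCMField.complexConj L) v) ((adelicForm L 3 H').map (adeleToLocal L v)) P'.val = finSum 2 1 G₁' G₂')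
    (hnn : ¬ ∃ z : LocalRing L v, IsUnit z ∧ G₁'.det = G₁.det * (conjLocal L (IsCMField.complexConj L) v z * z))
    (ε' : (cmDatum L 3 H').Local v)
    (hε' : (ε'.val.val : Matrix (Fin 3) (Fin 3) (LocalRing L v)) * P'.val =
      P'.val * finSum 2 1 (a • (1 : Matrix (Fin 2) (Fin 2) (LocalRing L v))) (εH.2.val.val : Matrix (Fin 1) (Fin 1) (LocalRing L v))) :
    ∃ (cb : L), IsCMField.complexConj L cb = cb ∧ cb ≠ 0 ∧ (cb = 1 ∨ cb = ξ₀) ∧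
      ∃ (T : GL (Fin (2 + 1)) (LocalRing L v))
        (hT : formCongr (conjLocal L (IsCMField.complexConj L) v) T (H'.map (algebraMap L (LocalRing L v))) =
          (1 : LocalRing L v) • (finSum 2 1 !![(1 : L), 0; 0, -ξ₀] !![cb]).map (algebraMap L (LocalRing L v)))
        (x : (cmDatum L (2 + 1) (finSum 2 1 !![(1 : L), 0; 0, -ξ₀] !![cb])).Local v),
        IsUnit (a - (εH.2.val.val : Matrix (Fin 1) (Fin 1) (LocalRing L v)) 0 0) ∧
        mat L (2 + 1) (finSum 2 1 !![(1 : L), 0; 0, -ξ₀] !![cb]) v x =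
          finSum 2 1 (a • (1 : Matrix (Fin 2) (Fin 2) (LocalRing L v))) (((εH.2.val.val : Matrix (Fin 1) (Fin 1) (LocalRing L v)) 0 0) • (1 : Matrix (Fin 1) (Fin 1) (LocalRing L v))) ∧
        cmDatumLocalCongr L v T isUnit_one hT x = ε' := by
  classical
  -- (0) the field `L ⊗ L⁺_v = L_w`, its involution `σ`, an anti-fixed `δ`
  set σ := conjLocal L (IsCMField.complexConj L) v with hσdef
  have hF : IsField (LocalRing L v) := LocalRing.isField_of_smul_eq (IsCMField.complexConj L) (IsCMField.complexConj_ne_one L) w hw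
  obtain ⟨x₀, hx₀⟩ := Literature.NumberTheory.NumberFields.IsCMField.exists_complexConj_ne L
  set δ : L := x₀ - IsCMField.complexConj L x₀ with hδdef
  have hcδ : IsCMField.complexConj L δ = -δ := by rw [hδdef, map_sub, IsCMField.complexConj_apply_apply, neg_sub]
  have hδ : δ ≠ 0 := fun h => hx₀ (sub_eq_zero.1 h).symm
  have hσσ : ∀ s, σ (σ s) = s := Liu2021.LemD1OfPlace.conjLocal_conjLocal_apply L v (IsCMField.complexConj L) hcδ hδ
  have hdet' : H'.det ≠ 0 := Godement.det_ne_zero_of_anisotropic L H' hanis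
  have hHv : (((adelicForm L 3 H').map (adeleToLocal L v)).map σ)ᵀ = (adelicForm L 3 H').map (adeleToLocal L v) :=
    map_conjLocal_transpose_localForm L 3 H' v hherm
  have hHvd : IsUnit ((adelicForm L 3 H').map (adeleToLocal L v)).det := UnitaryGroup.isUnit_det_localForm L 3 H' v hdet'
  have hunit_of_ne : ∀ {t : LocalRing L v}, t ≠ 0 → IsUnit t := fun {t} ht => by
    obtain ⟨s, hs⟩ := hF.mul_inv_cancel ht
    exact isUnit_iff_exists_inv.2 ⟨s, hs⟩
  -- (1) blocks of the bad frame
  obtain ⟨hG₁'h, hgσ, hG₁'d, hgu⟩ := blocks_of_twistGram_eq_finSum σ hσσ hHv hHvd P' hP'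
  -- (2) the bad block is anisotropic, the global `ξ₀` is not a norm, index two
  have hbad := not_exists_neg_det_badBlock_eq_norm L H' v w hw hherm hdet' θ hθ hW hPW hnn
  have hϖu : IsUnit (algebraMap L (LocalRing L v) ξ₀) := (IsUnit.mk0 ξ₀ hξ0).map _
  have hϖσ' : σ (algebraMap L (LocalRing L v) ξ₀) = algebraMap L (LocalRing L v) ξ₀ := by
    rw [hσdef, Literature.NumberTheory.Rogawski1990.conjLocal_algebraMap, hξc]
  have hϖnn : ¬ ∃ z : LocalRing L v, IsUnit z ∧ algebraMap L (LocalRing L v) ξ₀ = σ z * z := hξnn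
  set ϖ : LocalRing L v := algebraMap L (LocalRing L v) ξ₀ with hϖdef
  have hϖσ : σ ϖ = ϖ := hϖσ'
  have hdetσ : σ (-G₁'.det) = -G₁'.det := by
    rw [map_neg]
    congr 1
    have h := congrArg Matrix.det hG₁'h
    rwa [Matrix.det_transpose, ← RingHom.mapMatrix_apply, ← RingHom.map_det] at h
  obtain ⟨z₁, hz₁u, hz₁⟩ := exists_norm_mul_of_not_exists_norm L v (IsCMField.complexConj L) hcδ hδ w hw hϖσ hϖu hdetσ hG₁'d.neg
    (fun ⟨z, hz, h⟩ => hϖnn ⟨z, hz, h⟩) (fun ⟨z, hz, h⟩ => hbad ⟨z, hz, h⟩)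
  -- (3) the plane congruence `ᵗσ(S₁) G₁′ S₁ = ⟨1, −ξ₀⟩_v`
  have hHa : (!![(1 : L), 0; 0, -ξ₀]).map (algebraMap L (LocalRing L v)) = !![(1 : LocalRing L v), 0; 0, -ϖ] := by
    rw [hϖdef]
    ext i j; fin_cases i <;> fin_cases j <;> simp
  have hHah : ((!![(1 : LocalRing L v), 0; 0, -ϖ]).map σ)ᵀ = !![(1 : LocalRing L v), 0; 0, -ϖ] := by
    ext i j; fin_cases i <;> fin_cases j <;> simp [hϖσ]
  have hHad : IsUnit (!![(1 : LocalRing L v), 0; 0, -ϖ]).det := by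
    rw [Matrix.det_fin_two_of]; simpa using hϖu.neg
  have hdet : ∃ z : LocalRing L v, IsUnit z ∧ (!![(1 : LocalRing L v), 0; 0, -ϖ]).det = G₁'.det * (σ z * z) := by
    refine ⟨↑(hz₁u.unit⁻¹), (hz₁u.unit⁻¹).isUnit, ?_⟩
    rw [Matrix.det_fin_two_of]
    have h3 : z₁ * ↑(hz₁u.unit⁻¹) = 1 := hz₁u.mul_val_inv
    have h4 : σ z₁ * σ ↑(hz₁u.unit⁻¹) = 1 := by rw [← map_mul, h3, map_one]
    -- `−ϖ = det G₁′ · N(z₁⁻¹)` from `−det G₁′ = N(z₁) ϖ`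
    have key : G₁'.det = -(σ z₁ * z₁ * ϖ) := by rw [← hz₁, neg_neg]
    rw [key]
    have e : -(σ z₁ * z₁ * ϖ) * (σ ↑(hz₁u.unit⁻¹) * ↑(hz₁u.unit⁻¹)) = -ϖ * ((σ z₁ * σ ↑(hz₁u.unit⁻¹)) * (z₁ * ↑(hz₁u.unit⁻¹))) := by ring
    rw [e, h3, h4]; simp
  obtain ⟨S₁, hS₁⟩ := exists_formCongr_eq_of_det_eq_mul_norm L v (IsCMField.complexConj L) hcδ hδ w hw hG₁'h hHah hG₁'d hHad hdet
  -- (4) the line: `g = (G₂′)₀₀` is a `σ`-fixed unit; rescale it to a GLOBAL `c_b ∈ {1, ξ₀}` (★ `exists_rescale_of_not_norm`, norm index two)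
  set g : LocalRing L v := G₂' 0 0 with hgdef
  obtain ⟨s, cb, hsu, hcbc, hcb0, hcb1ξ, hcbloc⟩ :=
    K2E3DockBlockModelOfNotNorm.exists_rescale_of_not_norm L v w hw hξc hξ0 hξnn hgσ hgu
  obtain ⟨S₂, hS₂v, hS₂⟩ := exists_gl_one_formCongr_eq σ hsu G₂'
  have hHb : (!![cb]).map (algebraMap L (LocalRing L v)) = formCongr σ S₂ G₂' := by
    rw [hS₂, ← hcbloc]
    ext i j; fin_cases i; fin_cases j; simp
  -- (5) the congruence `T = P′ · (S₁ ⊕ᶠ S₂)`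
  obtain ⟨S, hS, hSi⟩ := exists_gl_val_eq_finSum S₁ S₂
  have hP'f : formCongr σ P' (H'.map (algebraMap L (LocalRing L v))) = finSum 2 1 G₁' G₂' := by
    rw [← Literature.NumberTheory.Rogawski1990.adelicForm_map_adeleToLocal L v H']; exact hP'
  have hT : formCongr σ (P' * S) (H'.map (algebraMap L (LocalRing L v))) =
      (1 : LocalRing L v) • (finSum 2 1 !![(1 : L), 0; 0, -ξ₀] !![cb]).map (algebraMap L (LocalRing L v)) := by
    rw [one_smul, finSum_map, formCongr_mul_of_finSum σ _ P' S S₁ S₂ hP'f hS, hS₁, hHa, hHb]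
  -- (6) the block-scalar preimage `x = φ_T⁻¹ ε′`
  set φ := cmDatumLocalCongr L v (P' * S) isUnit_one hT with hφdef
  refine ⟨cb, hcbc, hcb0, hcb1ξ, P' * S, hT, φ.symm ε', hunit_of_ne (sub_ne_zero.2 hu.symm), ?_, φ.apply_symm_apply ε'⟩
  -- the matrix of `x`: `(P′S)·mat x·(P′S)⁻¹ = ε′`
  have hconj : (P' * S) * (φ.symm ε').val * (P' * S)⁻¹ = ε'.val := by
    rw [← coe_cmDatumLocalCongr_apply L v (P' * S) isUnit_one hT (φ.symm ε')]
    exact congrArg Subtype.val (φ.apply_symm_apply ε')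
  have hx1 : (φ.symm ε').val = S⁻¹ * (P'⁻¹ * ε'.val * P') * S := by
    rw [← hconj]; group
  have hPε : (P'⁻¹).val * (ε'.val.val : Matrix (Fin 3) (Fin 3) (LocalRing L v)) * P'.val =
      finSum 2 1 (a • (1 : Matrix (Fin 2) (Fin 2) (LocalRing L v))) (εH.2.val.val : Matrix (Fin 1) (Fin 1) (LocalRing L v)) := by
    rw [Matrix.mul_assoc, hε', ← Matrix.mul_assoc, ← Units.val_mul, inv_mul_cancel, Units.val_one, Matrix.one_mul]
  have hx2 : ((P'⁻¹ * ε'.val * P' : GL (Fin (2 + 1)) (LocalRing L v)).val : Matrix (Fin (2 + 1)) (Fin (2 + 1)) (LocalRing L v)) =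
      finSum 2 1 (a • (1 : Matrix (Fin 2) (Fin 2) (LocalRing L v))) (εH.2.val.val : Matrix (Fin 1) (Fin 1) (LocalRing L v)) := by
    rw [Units.val_mul, Units.val_mul]; exact hPε
  rw [mat_def, hx1, Units.val_mul, Units.val_mul, hx2, finSum_inv_mul_scalar_mul S S₁ S₂ hS hSi, ← fin_one_eq_smul_one]

end Summit.HodgeConjecture.HodgeConjecture.Cruxes.H413.K2E3CompactSheetBlockModelOfNotNorm

end
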